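import Summits.KontsevichZagierPeriods.KontsevichZagierPeriods.Theorems.RootDecompWalshStrataHtypeConicPole

/-!
# Root decomposition (Walsh strata), part 60 — H-type XV: conic-edge family, perfect-square radicand; head

The last sub-family of the conic-edge residual: `E′ = (m + q₂²)e − mq₁² ≠ 0` and `E′(4E′G′ − F′²) = 0`,
i.e. `Δ = E′(x − ρ)²` with `ρ = mq₀q₁/E′ ∈ ℚ`.  `E′ < 0` has empty domain; `q₀ = 0` forces `g = 0` and a
vanishing integrand; otherwise `g > 0` and on each sign piece `x ≷ ρ` one has `√Δ = ±√E′(x − ρ)`, so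
`(mℓ + s q₂√Δ)²/√Δ = 2 s m q₂ ℓ + (±1/E′)·(m²ℓ² + q₂²Δ)·√E′/(x − ρ)`: the rational summand is peeled off
(LANDED `peel_rat`, hull `[0, 1]`) and the rest is `InBaker.of_pole_H2` (part 59) with
`P = (±1/E′)·hCxNB`.  With parts 57–58 this DISCHARGES the conic-edge residual `R-HCx` completely, so the
quadric Baker descent now rests on ONE typed residual:
`quadricBakerDescent_of_residuals₁₁ : R-Eθ → …Theses.RootDecompWalshStrata.QuadricBakerDescent`.

References: [KontsevichZagier2001 §1.2 rules (1)–(3)], [BCR1998 §2.2].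
-/

noncomputable section

open Set MeasureTheory MvPolynomial Literature.NumberTheory.Transcendental
open Literature.ModelTheory.ExponentialFields (IsSemialgebraic isSemialgebraic_univ isSemialgebraic_empty)
open Summit.KontsevichZagierPeriods.RootDecompWalshStrata.ConicDescent.VertexChart

namespace Summit.KontsevichZagierPeriods.RootDecompWalshStrata.ConicDescent.BallCube

/-! #### 60.1 One sign piece of the perfect-square conic-edge family -/

/-- **Perfect-square conic radicand, one sign piece.**  On a piece where `s′(x − ρ) > 0` (so
`√(E₁(x − ρ)²) = s′√E₁(x − ρ)`), with `g > 0`: expanding `(mℓ + s q₂ √Δ)²/√Δ` gives the rational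
summand `2 s m q₂ γ Hi n ℓ/H²` (peeled off by the LANDED `peel_rat` on the hull `[0, 1]`) plus
`(s′/E₁)·hCxNB(x)/((x − ρ)H²)·√E₁`, which is `InBaker.of_pole_H2`. [KontsevichZagier2001 §1.2; this node] -/
theorem InBaker.of_HCx_square_piece (e g m γ q0 q1 q2 s E1 ρ s' : ℚ) (he : 0 < e) (hg : 0 < g)
    (hE1 : 0 < E1) (hs : s = 1 ∨ s = -1) (hs' : s' = 1 ∨ s' = -1)
    (hrad : ∀ x : ℝ, ((m : ℝ) + q2 ^ 2) * ((e : ℝ) * x ^ 2 + g) - m * ((q0 : ℝ) + q1 * x) ^ 2 =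
      (E1 : ℝ) * (x - ρ) ^ 2)
    (r : KZ.IntegralRep 1)
    (hdom : ∀ v ∈ r.domain, (0 ≤ v 0 ∧ v 0 ≤ 1) ∧ 0 < (s' : ℝ) * (v 0 - ρ))
    (hri : EqOn r.integrand (fun t => (γ : ℝ) * ((e : ℝ) / 3 * t 0 ^ 3 + g * t 0) *
      ((q1 : ℝ) * g - e * q0 * t 0) *
        ((m : ℝ) * ((q0 : ℝ) + q1 * t 0) + s * q2 * √((E1 : ℝ) * (t 0 - ρ) ^ 2)) ^ 2 /
        (((e : ℝ) * t 0 ^ 2 + g) ^ 2 * √((E1 : ℝ) * (t 0 - ρ) ^ 2))) r.domain) :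
    InBaker (KZ.of r) := by
  have he0 : (0 : ℝ) < e := by exact_mod_cast he
  have hg0 : (0 : ℝ) < g := by exact_mod_cast hg
  have hE10 : (0 : ℝ) < E1 := by exact_mod_cast hE1
  have hH : ∀ x : ℝ, 0 < (e : ℝ) * x ^ 2 + g := fun x => by positivity
  have hqD : ∀ y : ℝ, qD 0 0 E1 y = E1 := fun y => by simp [qD]
  have hsabs : ∀ y : ℝ, 0 < (s' : ℝ) * y → |y| = (s' : ℝ) * y := by
    intro y hy
    rcases hs' with rfl | rfl
    · push_cast at hy ⊢
      rw [one_mul] at hy ⊢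
      exact abs_of_pos hy
    · push_cast at hy ⊢
      have hy' : y < 0 := by linarith
      rw [abs_of_neg hy']
      ring
  have hsq : ∀ v ∈ r.domain, √((E1 : ℝ) * (v 0 - ρ) ^ 2) = √(E1 : ℝ) * ((s' : ℝ) * (v 0 - ρ)) :=
    fun v hv => by
      rw [Real.sqrt_mul' _ (sq_nonneg _), Real.sqrt_sq_eq_abs, hsabs _ (hdom v hv).2]
  have hI01 : ∀ v ∈ r.domain, ((0 : ℚ) : ℝ) ≤ v 0 ∧ v 0 ≤ ((1 : ℚ) : ℝ) := fun v hv => by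
    push_cast
    exact (hdom v hv).1
  have hQ : ∀ x : ℝ, ((0 : ℚ) : ℝ) ≤ x → x ≤ ((1 : ℚ) : ℝ) → Polynomial.aeval x (hP e g ^ 2) ≠ 0 :=
    fun x _ _ => by
      rw [map_pow, aeval_hP]
      exact pow_ne_zero 2 (hH x).ne'
  refine InBaker.peel_rat (hCxNA e g m γ q0 q1 q2 s) (hP e g ^ 2) 0 1 hQ r hI01
    (fun t => Polynomial.aeval (t 0) (Polynomial.C (s' / E1) * hCxNB e g m γ q0 q1 q2) /
      ((t 0 - ρ) * ((e : ℝ) * t 0 ^ 2 + g) ^ 2) * √(qD 0 0 E1 (t 0))) (fun v hv => ?_)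
    fun rB hBd hBi => InBaker.of_pole_H2 E1 ρ e g _ (natDegree_C_mul_hCxNB_le _ e g m γ q0 q1 q2) hE1 he hg
      rB (fun v hv => ?_) hBi
  swap
  · have hv1 : v ∈ r.domain := by rw [hBd] at hv; exact hv
    have h := hdom v hv1
    refine ⟨h.1, fun h0 => ?_⟩
    have h2 := h.2
    rw [h0, sub_self, mul_zero] at h2
    exact lt_irrefl _ h2
  · obtain ⟨w, hw⟩ : ∃ w : ℝ, w = √(E1 : ℝ) := ⟨_, rfl⟩
    have hw0 : 0 < w := by rw [hw]; exact Real.sqrt_pos.2 hE10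
    have hw0' : w ≠ 0 := hw0.ne'
    have hw2 : w ^ 2 = E1 := by rw [hw]; exact Real.sq_sqrt hE10.le
    have hw' : w = (E1 : ℝ) / w := by rw [eq_div_iff hw0', ← hw2]; ring
    have hL := (hdom v hv).2
    have hxρ : v 0 - (ρ : ℝ) ≠ 0 := fun h => by rw [h, mul_zero] at hL; exact lt_irrefl _ hL
    have hHne := (hH (v 0)).ne'
    have hE1ne : (E1 : ℝ) ≠ 0 := hE10.ne'
    have hs2 : (s : ℝ) ^ 2 = 1 := by rcases hs with rfl | rfl <;> norm_num
    have hs2' : (s' : ℝ) ^ 2 = 1 := by rcases hs' with rfl | rfl <;> norm_num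
    have hsq' : ((m : ℝ) * ((q0 : ℝ) + q1 * v 0) + s * q2 * (w * ((s' : ℝ) * (v 0 - ρ)))) ^ 2 =
        (m : ℝ) ^ 2 * ((q0 : ℝ) + q1 * v 0) ^ 2 +
          2 * (s : ℝ) * s' * q2 * m * ((q0 : ℝ) + q1 * v 0) * (v 0 - ρ) * w +
          (q2 : ℝ) ^ 2 * ((E1 : ℝ) * (v 0 - ρ) ^ 2) := by
      linear_combination ((q2 : ℝ) ^ 2 * (v 0 - ρ) ^ 2 * (s' : ℝ) ^ 2 * w ^ 2) * hs2 +
        ((q2 : ℝ) ^ 2 * (v 0 - ρ) ^ 2 * w ^ 2) * hs2' + ((q2 : ℝ) ^ 2 * (v 0 - ρ) ^ 2) * hw2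
    rw [hri hv]
    dsimp only
    rw [hsq v hv, map_pow, aeval_hP, aeval_hCxNA, map_mul, Polynomial.aeval_C, eq_ratCast, aeval_hCxNB,
      hrad, hqD, ← hw, hsq']
    conv_rhs => rw [hw']
    rcases hs' with rfl | rfl
    · push_cast
      field_simp
      ring
    · push_cast
      field_simp
      ring

/-! #### 60.2 The conic-edge family with perfect-square radicand -/

/-- **Conic-edge family, PERFECT-SQUARE radicand** (`E′ ≠ 0`, `E′(4E′G′ − F′²) = 0`): `E′ < 0` has empty
domain; `q₀ = 0` forces `g = 0` and a vanishing integrand; otherwise `g > 0`, `Δ = E′(x − ρ)²` with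
`ρ = mq₀q₁/E′ ∈ ℚ`, and the two sign pieces `x ≷ ρ` are `InBaker.of_HCx_square_piece`.
[KontsevichZagier2001 §1.2 rules (1)–(3); this node] -/
theorem InBaker.of_HCx_square (e g m γ q0 q1 q2 s : ℚ) (he : 0 < e) (hm : 1 ≤ m) (hs : s = 1 ∨ s = -1)
    (h0 : (m + q2 ^ 2) * e - m * q1 ^ 2 ≠ 0)
    (hdisc : ((m + q2 ^ 2) * e - m * q1 ^ 2) *
      (4 * ((m + q2 ^ 2) * e - m * q1 ^ 2) * ((m + q2 ^ 2) * g - m * q0 ^ 2) - (2 * m * q0 * q1) ^ 2) = 0)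
    (S : Set (Fin 1 → ℝ)) (hS : IsSemialgebraic ℚ S)
    (hdom : ∀ t ∈ S, (0 ≤ t 0 ∧ t 0 ≤ 1) ∧ 0 < (e : ℝ) * t 0 ^ 2 + g ∧
      0 < ((m : ℝ) + q2 ^ 2) * ((e : ℝ) * t 0 ^ 2 + g) - m * ((q0 : ℝ) + q1 * t 0) ^ 2)
    (r : KZ.IntegralRep 1) (hrd : r.domain = S)
    (hri : EqOn r.integrand (fun t => (γ : ℝ) * ((e : ℝ) / 3 * t 0 ^ 3 + g * t 0) *
      ((q1 : ℝ) * g - e * q0 * t 0) *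
        ((m : ℝ) * ((q0 : ℝ) + q1 * t 0) +
          s * q2 * √(((m : ℝ) + q2 ^ 2) * ((e : ℝ) * t 0 ^ 2 + g) - m * ((q0 : ℝ) + q1 * t 0) ^ 2)) ^ 2 /
        (((e : ℝ) * t 0 ^ 2 + g) ^ 2 *
          √(((m : ℝ) + q2 ^ 2) * ((e : ℝ) * t 0 ^ 2 + g) - m * ((q0 : ℝ) + q1 * t 0) ^ 2))) S) :
    InBaker (KZ.of r) := by
  have _hS := hS
  subst hrd
  have hm0 : 0 < m := zero_lt_one.trans_le hm
  have hM : 0 < m + q2 ^ 2 := by positivity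
  obtain ⟨E1, hE1⟩ : ∃ E1 : ℚ, E1 = (m + q2 ^ 2) * e - m * q1 ^ 2 := ⟨_, rfl⟩
  rw [← hE1] at h0 hdisc
  have hdisc' : 4 * E1 * ((m + q2 ^ 2) * g - m * q0 ^ 2) = (2 * m * q0 * q1) ^ 2 := by
    have h := (mul_eq_zero.1 hdisc).resolve_left h0
    linarith
  obtain ⟨ρ, hρ⟩ : ∃ ρ : ℚ, ρ = m * q0 * q1 / E1 := ⟨_, rfl⟩
  have hρ1 : E1 * ρ = m * q0 * q1 := by rw [hρ]; exact mul_div_cancel₀ _ h0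
  have hρ2 : E1 * ρ ^ 2 = (m + q2 ^ 2) * g - m * q0 ^ 2 := by
    have h3 : E1 * (E1 * ρ ^ 2) = E1 * ((m + q2 ^ 2) * g - m * q0 ^ 2) := by
      rw [show E1 * (E1 * ρ ^ 2) = (E1 * ρ) ^ 2 by ring, hρ1]
      linear_combination (-1 / 4 : ℚ) * hdisc'
    exact mul_left_cancel₀ h0 h3
  have hradR : ∀ x : ℝ, ((m : ℝ) + q2 ^ 2) * ((e : ℝ) * x ^ 2 + g) - m * ((q0 : ℝ) + q1 * x) ^ 2 =
      (E1 : ℝ) * (x - ρ) ^ 2 := by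
    intro x
    have h1 : (E1 : ℝ) = ((m : ℝ) + q2 ^ 2) * e - m * q1 ^ 2 := by rw [hE1]; push_cast; ring
    have h2 : (E1 : ℝ) * ρ = m * q0 * q1 := by exact_mod_cast hρ1
    have h3 : (E1 : ℝ) * ρ ^ 2 = ((m : ℝ) + q2 ^ 2) * g - m * q0 ^ 2 := by exact_mod_cast hρ2
    linear_combination (-(x ^ 2)) * h1 + (2 * x) * h2 - h3
  rcases lt_or_gt_of_ne h0 with hneg | hpos
  · -- `E′ < 0`: the domain is empty
    refine InBaker.of_domain_eq_empty r (Set.eq_empty_of_subset_empty fun v hv => ?_)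
    exfalso
    obtain ⟨-, -, h3⟩ := hdom v hv
    have hneg' : (E1 : ℝ) ≤ 0 := by exact_mod_cast hneg.le
    have h4 : (E1 : ℝ) * (v 0 - ρ) ^ 2 ≤ 0 := mul_nonpos_iff.2 (Or.inr ⟨hneg', sq_nonneg _⟩)
    linarith [hradR (v 0)]
  by_cases hq0 : q0 = 0
  · -- `q₀ = 0`: then `ρ = 0`, `g = 0` and the integrand vanishes
    have hρ0 : ρ = 0 := by rw [hρ, hq0]; simp
    have hg0 : g = 0 := by
      have h := hρ2
      rw [hρ0, hq0] at h
      have h' : (m + q2 ^ 2) * g = 0 := by linear_combination (-1 : ℚ) * h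
      rcases mul_eq_zero.1 h' with h'' | h''
      · exact absurd h'' hM.ne'
      · exact h''
    exact InBaker.of_eqOn_ratCast r 0 fun v hv => by
      rw [hri hv, hq0, hg0]
      simp
  -- `q₀ ≠ 0`: `g > 0`; split at `ρ`
  have hq0sq : 0 < q0 ^ 2 := lt_of_le_of_ne (sq_nonneg q0) (Ne.symm (pow_ne_zero 2 hq0))
  have hg : 0 < g := by
    rcases lt_or_ge 0 g with hg | hle
    · exact hg
    · exfalso
      have h5 : (m + q2 ^ 2) * g ≤ 0 := mul_nonpos_iff.2 (Or.inl ⟨hM.le, hle⟩)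
      nlinarith [mul_nonneg hpos.le (sq_nonneg ρ), mul_pos hm0 hq0sq, hρ2]
  refine InBaker.of_split_at ρ r (fun r₁ hd₁ hi₁ => ?_) fun r₁ hd₁ hi₁ => ?_
  · -- `x > ρ`
    refine InBaker.of_HCx_square_piece e g m γ q0 q1 q2 s E1 ρ 1 he hg hpos hs (Or.inl rfl) hradR r₁
      (fun v hv => ?_) fun v hv => ?_
    · rw [hd₁] at hv
      obtain ⟨hvS, hvρ⟩ := hv
      have hvρ' : (ρ : ℝ) < v 0 := hvρ
      refine ⟨(hdom v hvS).1, ?_⟩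
      push_cast
      linarith
    · have hvS : v ∈ r.domain := by rw [hd₁] at hv; exact hv.1
      rw [hi₁, hri hvS]
      dsimp only
      rw [hradR]
  · -- `x < ρ`
    refine InBaker.of_HCx_square_piece e g m γ q0 q1 q2 s E1 ρ (-1) he hg hpos hs (Or.inr rfl) hradR r₁
      (fun v hv => ?_) fun v hv => ?_
    · rw [hd₁] at hv
      obtain ⟨hvS, hvρ⟩ := hv
      have hvρ' : v 0 < (ρ : ℝ) := hvρ
      refine ⟨(hdom v hvS).1, ?_⟩
      push_cast
      linarith
    · have hvS : v ∈ r.domain := by rw [hd₁] at hv; exact hv.1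
      rw [hi₁, hri hvS]
      dsimp only
      rw [hradR]

/-! #### 60.3 The conic-edge residual discharged; head -/

/-- **`R-HCx°°` holds**: the perfect-square sub-family is `InBaker.of_HCx_square`. [this node] -/
theorem InBaker.of_Hconics_xdd :
    (∀ (e g m γ q0 q1 q2 s : ℚ), 0 < e → 1 ≤ m → (s = 1 ∨ s = -1) → (m + q2 ^ 2) * e - m * q1 ^ 2 ≠ 0 →
      ((m + q2 ^ 2) * e - m * q1 ^ 2) *
          (4 * ((m + q2 ^ 2) * e - m * q1 ^ 2) * ((m + q2 ^ 2) * g - m * q0 ^ 2) - (2 * m * q0 * q1) ^ 2) = 0 →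
      ∀ (S : Set (Fin 1 → ℝ)), IsSemialgebraic ℚ S →
        (∀ t ∈ S, (0 ≤ t 0 ∧ t 0 ≤ 1) ∧ 0 < (e : ℝ) * t 0 ^ 2 + g ∧
          0 < ((m : ℝ) + q2 ^ 2) * ((e : ℝ) * t 0 ^ 2 + g) - m * ((q0 : ℝ) + q1 * t 0) ^ 2) →
        ∀ r : KZ.IntegralRep 1, r.domain = S →
          EqOn r.integrand (fun t => (γ : ℝ) * ((e : ℝ) / 3 * t 0 ^ 3 + g * t 0) * ((q1 : ℝ) * g - e * q0 * t 0) *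
            ((m : ℝ) * ((q0 : ℝ) + q1 * t 0) +
              s * q2 * √(((m : ℝ) + q2 ^ 2) * ((e : ℝ) * t 0 ^ 2 + g) - m * ((q0 : ℝ) + q1 * t 0) ^ 2)) ^ 2 /
            (((e : ℝ) * t 0 ^ 2 + g) ^ 2 *
              √(((m : ℝ) + q2 ^ 2) * ((e : ℝ) * t 0 ^ 2 + g) - m * ((q0 : ℝ) + q1 * t 0) ^ 2))) S →
          InBaker (KZ.of r)) := by
  intro e g m γ q0 q1 q2 s he hm hs h0 hdisc S hS hdom r hrd hri
  exact InBaker.of_HCx_square e g m γ q0 q1 q2 s he hm hs h0 hdisc S hS hdom r hrd hri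

/-! #### 60.4 Head -/

/-- **`QuadricBakerDescent` from ONE typed residual, v11.**  The E-type stratum off its two thin wall
strata (parts 40–43), the rank `≤ 1` stratum (44–46) and now the WHOLE H-type stratum (`disc < 0`; 47–60:
vertex chart, sections, atoms, frames, line and conic edges reduced to one variable, the generic Euler
families, and every degenerate radicand — constant, linear, perfect square) are DISCHARGED.  What remains
is `R-Eθ`: the E-type quadrics (`0 < disc`) with a boundary wall pair that is NOT `good` in the Lagrange
chart (a clause of `goodWalls` fails: the degenerate parallel / centre-through-wall / double-root corner
strata of part 43).  Blueprint: NODE.md GEN 10 MENU item (3) (corners (θ1)/(θ2): a `psection` variant for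
the parallel pair with the LANDED `sqrt_const`, the `Y = 0` end peeled with a margin, and the double-root
radicand by `sqrt_const_pole` at an endpoint).  [KontsevichZagier2001 §1.2; this node] -/
theorem quadricBakerDescent_of_residuals₁₁
    (hθ : (∀ (L : Quadric₃) (ℓ₁ ℓ₂ g : Wall) (γ : ℚ) (σ : Fin 6 → SignType) (r : KZ.IntegralRep 2),
      0 < L.dq.disc →
      ¬((L.bwall ℓ₁).precomp L.dq.lagM.inv ∈ goodWalls 1 L.dq.eκ L.dq.d11 L.dq.cst ∧
          (L.bwall ℓ₂).precomp L.dq.lagM.inv ∈ goodWalls 1 L.dq.eκ L.dq.d11 L.dq.cst) →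
      r.domain = atomFam (L.wfam ℓ₁ ℓ₂ g) σ →
      EqOn r.integrand (fun v => (γ : ℝ) * √(L.Dxy (v 0) (v 1))) r.domain → InBaker (KZ.of r))) :
    Summit.KontsevichZagierPeriods.KontsevichZagierPeriods.Theses.RootDecompWalshStrata.QuadricBakerDescent :=
  quadricBakerDescent_of_residuals₁₀ InBaker.of_Hconics_xdd hθ

end Summit.KontsevichZagierPeriods.RootDecompWalshStrata.ConicDescent.BallCube
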